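import Mathlib.Analysis.Normed.Field.Approximation
import Mathlib.Analysis.Complex.Polynomial.Basic
import Mathlib.FieldTheory.Minpoly.IsIntegrallyClosed
import Mathlib.FieldTheory.Separable
import Mathlib.RingTheory.Localization.Integral
import Mathlib.RingTheory.Polynomial.GaussLemma
import Mathlib.RingTheory.Polynomial.UniqueFactorization
import Mathlib.Topology.Algebra.MvPolynomial
import Literature.NumberTheory.Transcendental.AnalytificationProperProofs
import HarnessLib

/-!
# Crux `RiemannWeightOne` (stmt-HodgeConjecture-16406), stub `stub_algebraisationSmooth`, part (B): a single-valued branch of an integral element is a simple root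

Helper file for the registered stub `stub_algebraisationSmooth` (Serre, GAGA §2 n°6: smoothness
of the reduced subscheme of `ℙᴺ_ℂ` under an embedded compact manifold). Let
`R = ℂ[T₁, …, T_d] → B` be an injective integral extension of domains (a Noether normalisation of
an affine piece of `X`), `ℓ ∈ B` with minimal polynomial `G ∈ R[Y]`, and `g_c ∈ ℂ[Y]` its
specialisation at `c ∈ ℂᵈ`. Complex points of `Spec B` are `ℂ`-algebra maps `ψ : B → ℂ`; the fibre
points over `c` have `ℓ`-values among the roots of `g_c`, and conversely (lying over).

* `RootCounting.eval_map_minpoly` / `isRoot_map_minpoly` — `g_{t(ψ)}(ψ ℓ) = 0`;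
* `RootCounting.exists_algHom_of_isRoot` — every root of `g_c` is `ψ(ℓ)` for a point `ψ` over `c`;
* `RootCounting.exists_separable_map` — off a proper Zariski-closed subset of `ℂᵈ` the
  specialisation `g_c` is separable (`G` is irreducible over `Frac R` by Gauss's lemma, hence
  separable in characteristic `0`; clear denominators in a Bézout identity);
* `RootCounting.derivative_eval_ne_zero_of_branch` — **the theorem.** Along parameters `m → m₀`
  (in the application: points of the manifold near `m₀`) let `τ(m) ∈ ℂᵈ`, `λ(m) ∈ ℂ` be continuous
  with a point `ψ_m` over `τ(m)` having `ψ_m(ℓ) = λ(m)` (a continuous BRANCH of `ℓ`), such that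
  (density) every non-zero `D ∈ R` has `D(τ m) ≠ 0` frequently, and (single-valuedness) for `m`
  near `m₀` every point over `τ(m)` whose `ℓ`-value is `η`-close to `λ(m₀)` has `ℓ`-value `λ(m)`.
  Then `λ(m₀)` is a SIMPLE root of `g_{τ(m₀)}`. Proof: `g_{τ m} = (Y - λ m) p_m` with `p_m`
  depending continuously on `m` (`Polynomial.coeff_divByMonic_X_sub_C`); if `p_{m₀}(λ m₀) = 0`,
  continuity of roots (`Polynomial.exists_roots_norm_sub_lt_of_norm_coeff_sub_lt`) gives for `m`
  close with `g_{τ m}` separable a root `b` of `p_m` close to `λ(m₀)`; `b = ψ(ℓ)` for a point over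
  `τ(m)`, so `b = λ(m)` by single-valuedness, a double root of the separable `g_{τ m}` — absurd.

Transversality of the projection makes the branch single-valued in the application, and the
conclusion `∂G/∂Y ≠ 0` feeds the Zariski cotangent space computation of part (A).

## References

* [SerreGAGA1956] J.-P. Serre, GAGA, Ann. Inst. Fourier 6 (1956), §2 n°6 Prop. 3 and Cor.
* [Forster1981] O. Forster, Lectures on Riemann Surfaces, §8 (algebraic functions).
-/

noncomputable section

set_option linter.dupNamespace false

namespace Summit.HodgeConjecture.HodgeConjecture.Theorems.RiemannWeightOne

namespace RootCounting

open Polynomial Filter Topology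
open scoped nonZeroDivisors

variable {d : ℕ} {B : Type*} [CommRing B] [Algebra ℂ B]
  [Algebra (MvPolynomial (Fin d) ℂ) B] [IsScalarTower ℂ (MvPolynomial (Fin d) ℂ) B]

local notation "R" => MvPolynomial (Fin d) ℂ

/-! ### Points and their coordinates -/

/-- The coordinates `t(ψ) ∈ ℂᵈ` of a point `ψ : B → ℂ`: the values of the `Tᵢ`. [folklore] -/
def coords (ψ : B →ₐ[ℂ] ℂ) : Fin d → ℂ := fun i => ψ (algebraMap R B (MvPolynomial.X i))

/-- A point `ψ` restricted to `R = ℂ[T]` is evaluation at its coordinates. [folklore] -/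
theorem comp_algebraMap (ψ : B →ₐ[ℂ] ℂ) :
    ψ.toRingHom.comp (algebraMap R B) = (MvPolynomial.eval (coords ψ) : R →+* ℂ) := by
  have h : ψ.comp (IsScalarTower.toAlgHom ℂ R B) = MvPolynomial.aeval (coords ψ) := by
    refine MvPolynomial.algHom_ext fun i => ?_
    simp [coords]
  have := congrArg AlgHom.toRingHom h
  exact this

/-- `ψ(p(ℓ)) = p_{t(ψ)}(ψ ℓ)` for `p ∈ R[Y]`. [folklore] -/
theorem algHom_aeval (ψ : B →ₐ[ℂ] ℂ) (ℓ : B) (p : R[X]) :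
    ψ (Polynomial.aeval ℓ p) = (p.map (MvPolynomial.eval (coords ψ))).eval (ψ ℓ) := by
  rw [Polynomial.aeval_def, eval_map, show ψ (eval₂ (algebraMap R B) ℓ p) =
    ψ.toRingHom (eval₂ (algebraMap R B) ℓ p) from rfl, Polynomial.hom_eval₂, comp_algebraMap]
  rfl

/-- **`g_{t(ψ)}(ψ ℓ) = 0`**: the `ℓ`-value of a point is a root of the minimal polynomial of `ℓ`
specialised at its coordinates. [folklore] -/
theorem isRoot_map_minpoly (ℓ : B) (ψ : B →ₐ[ℂ] ℂ) :
    ((minpoly R ℓ).map (MvPolynomial.eval (coords ψ))).IsRoot (ψ ℓ) := by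
  rw [IsRoot, ← algHom_aeval, minpoly.aeval, map_zero]

/-! ### Lying over: roots come from points -/

/-- **Every root of `g_c` is the `ℓ`-value of a point over `c`** (`R → B` injective and integral,
`B` a domain): the map `R[Y] → ℂ`, `Y ↦ μ`, coefficients evaluated at `c`, kills `G`, hence the
kernel `(G)` of `R[Y] → B` (`minpoly.ker_eval`, `R` integrally closed), so it extends along the
integral map `R[Y] → B` (lying over + Nullstellensatz, the tree's
`AlgHomClosure.exists_ringHom_comp_eq_of_isIntegral`). [folklore] -/
theorem exists_algHom_of_isRoot [IsDomain B] [Module.IsTorsionFree R B] [Algebra.IsIntegral R B]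
    (ℓ : B) (c : Fin d → ℂ) (μ : ℂ)
    (hμ : ((minpoly R ℓ).map (MvPolynomial.eval c)).IsRoot μ) :
    ∃ ψ : B →ₐ[ℂ] ℂ, coords ψ = c ∧ ψ ℓ = μ := by
  have hℓ : IsIntegral R ℓ := Algebra.IsIntegral.isIntegral ℓ
  set j : R[X] →+* B := (Polynomial.aeval ℓ : R[X] →ₐ[R] B).toRingHom with hj
  set χ : R[X] →+* ℂ := Polynomial.eval₂RingHom (MvPolynomial.eval c : R →+* ℂ) μ with hχ
  -- `j` is integral
  have hjint : j.IsIntegral := by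
    intro b
    obtain ⟨p, hpm, hp⟩ := (Algebra.IsIntegral.isIntegral b : IsIntegral (MvPolynomial (Fin d) ℂ) b)
    refine ⟨p.map (Polynomial.C : R →+* R[X]), hpm.map _, ?_⟩
    rw [eval₂_map]
    have hcomp : j.comp (Polynomial.C : R →+* R[X]) = algebraMap R B :=
      RingHom.ext fun r => by simp [hj]
    rw [hcomp]
    exact hp
  -- `ker j = (G) ≤ ker χ`
  have hker : RingHom.ker j ≤ RingHom.ker χ := by
    rw [hj, minpoly.ker_eval hℓ, Ideal.span_le, Set.singleton_subset_iff, SetLike.mem_coe,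
      RingHom.mem_ker, hχ, coe_eval₂RingHom, ← eval_map]
    exact hμ
  obtain ⟨Φ, hΦ⟩ :=
    Literature.NumberTheory.Transcendental.AlgHomClosure.exists_ringHom_comp_eq_of_isIntegral j hjint χ hker
  have hΦC : ∀ r : R, Φ (algebraMap R B r) = MvPolynomial.eval c r := fun r => by
    have h := congrArg (fun f : R[X] →+* ℂ => f (Polynomial.C r)) hΦ
    simp only [RingHom.comp_apply, hj, hχ, AlgHom.toRingHom_eq_coe, AlgHom.coe_toRingHom,
      Polynomial.aeval_C, coe_eval₂RingHom, eval₂_C] at h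
    exact h
  refine ⟨{ Φ with commutes' := fun z => ?_ }, funext fun i => ?_, ?_⟩
  · -- scalars: `algebraMap ℂ B z = algebraMap R B (C z)`
    change Φ (algebraMap ℂ B z) = z
    rw [IsScalarTower.algebraMap_apply ℂ R B, hΦC, MvPolynomial.algebraMap_eq, MvPolynomial.eval_C]
  · change Φ (algebraMap R B (MvPolynomial.X i)) = c i
    rw [hΦC, MvPolynomial.eval_X]
  · change Φ ℓ = μ
    have h := congrArg (fun f : R[X] →+* ℂ => f Polynomial.X) hΦ
    simp only [RingHom.comp_apply, hj, hχ, AlgHom.toRingHom_eq_coe, AlgHom.coe_toRingHom,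
      Polynomial.aeval_X, coe_eval₂RingHom, eval₂_X] at h
    exact h

/-! ### Separability of the specialised minimal polynomial off a proper closed subset -/

omit [Algebra ℂ B] [IsScalarTower ℂ (MvPolynomial (Fin d) ℂ) B] in
/-- **Generic separability.** For `ℓ` in a domain `B` integral over `R = ℂ[T]` (acting faithfully),
there is `0 ≠ D ∈ R` such that `g_c = G(c, ·)` is separable whenever `D(c) ≠ 0`: `G` is
irreducible over `Frac R` (Gauss's lemma, `R` is factorial), hence separable (characteristic `0`),
and a Bézout identity `u G + v G' = 1` over `Frac R` clears to `u₁ G + v₁ G' = D` over `R`.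
[folklore] -/
theorem exists_separable_map [IsDomain B] [Module.IsTorsionFree R B] [Algebra.IsIntegral R B]
    (ℓ : B) : ∃ D : R, D ≠ 0 ∧ ∀ c : Fin d → ℂ, MvPolynomial.eval c D ≠ 0 →
      ((minpoly R ℓ).map (MvPolynomial.eval c)).Separable := by
  classical
  have hℓ : IsIntegral R ℓ := Algebra.IsIntegral.isIntegral ℓ
  set G := minpoly R ℓ with hG
  set K := FractionRing R
  -- `G` is irreducible over `K`, hence separable
  have hirrK : Irreducible (G.map (algebraMap R K)) :=
    ((minpoly.monic hℓ).irreducible_iff_irreducible_map_fraction_map).1 (minpoly.irreducible hℓ)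
  have hsepK : (G.map (algebraMap R K)).Separable := hirrK.separable
  obtain ⟨u, v, huv⟩ := hsepK
  -- clear denominators
  obtain ⟨b₁, hb₁M, hb₁⟩ := IsLocalization.integerNormalization_spec R⁰ u
  obtain ⟨b₂, hb₂M, hb₂⟩ := IsLocalization.integerNormalization_spec R⁰ v
  set u₁ := IsLocalization.integerNormalization R⁰ u with hu₁
  set v₁ := IsLocalization.integerNormalization R⁰ v with hv₁
  have hinj : Function.Injective (algebraMap R K) := IsFractionRing.injective R K
  have hident : Polynomial.C b₂ * u₁ * G + Polynomial.C b₁ * v₁ * derivative G =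
      Polynomial.C (b₁ * b₂) := by
    apply Polynomial.map_injective (algebraMap R K) hinj
    simp only [Polynomial.map_add, Polynomial.map_mul, Polynomial.map_C, hb₁, hb₂,
      map_mul, Algebra.smul_def, Polynomial.algebraMap_apply]
    rw [Polynomial.derivative_map] at huv
    linear_combination (Polynomial.C (algebraMap R K b₁) * Polynomial.C (algebraMap R K b₂)) * huv
  refine ⟨b₁ * b₂, mul_ne_zero (nonZeroDivisors.ne_zero hb₁M) (nonZeroDivisors.ne_zero hb₂M),
    fun c hc => ?_⟩
  -- specialise the identity at `c`
  have h := congrArg (Polynomial.map (MvPolynomial.eval c : R →+* ℂ)) hident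
  simp only [Polynomial.map_add, Polynomial.map_mul, Polynomial.map_C] at h
  set Dc := MvPolynomial.eval c (b₁ * b₂) with hDc
  have hinv : Polynomial.C Dc⁻¹ * Polynomial.C Dc = (1 : ℂ[X]) := by
    rw [← Polynomial.C_mul, inv_mul_cancel₀ hc, Polynomial.C_1]
  refine ⟨Polynomial.C Dc⁻¹ * (Polynomial.C (MvPolynomial.eval c b₂) * u₁.map (MvPolynomial.eval c)),
    Polynomial.C Dc⁻¹ * (Polynomial.C (MvPolynomial.eval c b₁) * v₁.map (MvPolynomial.eval c)), ?_⟩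
  rw [Polynomial.derivative_map]
  linear_combination (Polynomial.C Dc⁻¹) * h + hinv

/-! ### Division by the branch -/

/-- If `λ` is a root of the monic `g`, then `g = (Y - λ) · (g /ₘ (Y - λ))` with monic quotient of
degree `deg g - 1`. [folklore] -/
theorem monic_divByMonic_of_isRoot {g : ℂ[X]} (hg : g.Monic) {lam : ℂ} (h : g.IsRoot lam) :
    (g /ₘ (X - C lam)).Monic ∧ (g /ₘ (X - C lam)).natDegree = g.natDegree - 1 ∧
      (X - C lam) * (g /ₘ (X - C lam)) = g := by
  have hmul : (X - C lam) * (g /ₘ (X - C lam)) = g := mul_divByMonic_eq_iff_isRoot.2 h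
  refine ⟨?_, ?_, hmul⟩
  · refine Monic.of_mul_monic_left (monic_X_sub_C lam) ?_
    rw [hmul]; exact hg
  · rw [natDegree_divByMonic g (monic_X_sub_C lam), natDegree_X_sub_C]

/-- The derivative of `g = (Y - λ) p` at `λ` is `p(λ)`. [folklore] -/
theorem derivative_eval_eq_of_isRoot {g : ℂ[X]} {lam : ℂ} (h : g.IsRoot lam) :
    g.derivative.eval lam = (g /ₘ (X - C lam)).eval lam := by
  have hmul : (X - C lam) * (g /ₘ (X - C lam)) = g := mul_divByMonic_eq_iff_isRoot.2 h
  conv_lhs => rw [← hmul]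
  simp [derivative_mul]

/-! ### The theorem -/

/-- **A single-valued continuous branch of an integral element is a simple root of the specialised
minimal polynomial.** See the module docstring for the statement and the proof (continuity of
roots + lying over + single-valuedness + generic separability). In the application `τ = t ∘ φ` and
`λ = ℓ ∘ φ` near a point `m₀` of the manifold where the finite projection `t` is transversal, and
the conclusion reads `∂G/∂Y (t P₀, ℓ P₀) ≠ 0`. [cite: SerreGAGA1956, §2 n°6 Prop. 3 and Cor.] -/
theorem derivative_eval_ne_zero_of_branch [IsDomain B] [Module.IsTorsionFree R B]
    [Algebra.IsIntegral R B] (ℓ : B) {S : Type*} [TopologicalSpace S] (m₀ : S)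
    (τ : S → (Fin d → ℂ)) (lam : S → ℂ) (hτ : ContinuousAt τ m₀) (hlam : ContinuousAt lam m₀)
    (hbranch : ∀ᶠ m in 𝓝 m₀, ∃ ψ : B →ₐ[ℂ] ℂ, coords ψ = τ m ∧ ψ ℓ = lam m)
    (hdense : ∀ D : R, D ≠ 0 → ∃ᶠ m in 𝓝 m₀, MvPolynomial.eval (τ m) D ≠ 0)
    (huniq : ∃ η : ℝ, 0 < η ∧ ∀ᶠ m in 𝓝 m₀, ∀ ψ : B →ₐ[ℂ] ℂ, coords ψ = τ m →
      ‖ψ ℓ - lam m₀‖ < η → ψ ℓ = lam m) :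
    (((minpoly R ℓ).map (MvPolynomial.eval (τ m₀))).derivative).eval (lam m₀) ≠ 0 := by
  classical
  have hℓ : IsIntegral R ℓ := Algebra.IsIntegral.isIntegral ℓ
  set G := minpoly R ℓ with hG
  have hGm : G.Monic := minpoly.monic hℓ
  set N := G.natDegree with hN
  -- the specialisations and the quotients by the branch
  set g : S → ℂ[X] := fun m => G.map (MvPolynomial.eval (τ m)) with hg
  have hgm : ∀ m, (g m).Monic := fun m => hGm.map _
  have hgdeg : ∀ m, (g m).natDegree = N := fun m => hGm.natDegree_map _
  have hroot : ∀ m (ψ : B →ₐ[ℂ] ℂ), coords ψ = τ m → ψ ℓ = lam m → (g m).IsRoot (lam m) := by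
    intro m ψ hc hl
    have h := isRoot_map_minpoly (d := d) ℓ ψ
    rw [hc, hl] at h
    exact h
  obtain ⟨ψ₀, hψ₀c, hψ₀ℓ⟩ := hbranch.self_of_nhds
  have hroot₀ : (g m₀).IsRoot (lam m₀) := hroot m₀ ψ₀ hψ₀c hψ₀ℓ
  set p : S → ℂ[X] := fun m => g m /ₘ (X - C (lam m)) with hp
  intro hder
  -- `p_{m₀}` has the root `λ(m₀)`
  have hp₀root : (p m₀).IsRoot (lam m₀) := by
    rw [IsRoot, hp]
    dsimp only
    rw [← derivative_eval_eq_of_isRoot hroot₀]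
    exact hder
  obtain ⟨hp₀m, hp₀deg, -⟩ := monic_divByMonic_of_isRoot (hgm m₀) hroot₀
  have hn₀pos : (p m₀).natDegree ≠ 0 := by
    intro h0
    have h1 : p m₀ = 1 := Polynomial.eq_one_of_monic_natDegree_zero hp₀m h0
    rw [h1, IsRoot, eval_one] at hp₀root
    exact one_ne_zero hp₀root
  -- the constants
  obtain ⟨D, hD0, hDsep⟩ := exists_separable_map (d := d) (B := B) ℓ
  obtain ⟨η, hη, huniq'⟩ := huniq
  set Mx : ℝ := max ‖lam m₀‖ 1 with hMx
  have hMxpos : 0 < Mx := lt_of_lt_of_le one_pos (le_max_right _ _)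
  set ρ : ℝ := η / (2 * Mx) with hρ
  have hρpos : 0 < ρ := by positivity
  set ε : ℝ := ρ ^ (p m₀).natDegree / ((p m₀).natDegree + 1) with hε
  have hεpos : 0 < ε := by positivity
  have hrad : (((p m₀).natDegree + 1 : ℝ) * ε) ^ ((p m₀).natDegree : ℝ)⁻¹ * Mx < η := by
    have h1 : ((p m₀).natDegree + 1 : ℝ) * ε = ρ ^ (p m₀).natDegree := by
      rw [hε]; field_simp
    rw [h1, Real.pow_rpow_inv_natCast hρpos.le hn₀pos, hρ]
    calc η / (2 * Mx) * Mx = η / 2 := by field_simp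
      _ < η := by linarith
  -- continuity of the coefficients of `p_m`
  have hcoef : ∀ i, Tendsto (fun m => (p m).coeff i) (𝓝 m₀) (𝓝 ((p m₀).coeff i)) := by
    intro i
    have hform : ∀ m, (p m).coeff i =
        ∑ j ∈ Finset.Icc (i + 1) N, lam m ^ (j - (i + 1)) * MvPolynomial.eval (τ m) (G.coeff j) := by
      intro m
      rw [hp]
      dsimp only
      rw [coeff_divByMonic_X_sub_C, hgdeg m]
      refine Finset.sum_congr rfl fun j _ => ?_
      rw [hg]
      dsimp only
      rw [coeff_map]
    simp_rw [hform]
    refine tendsto_finsetSum _ fun j _ => ?_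
    exact (hlam.pow _).mul ((MvPolynomial.continuous_eval _).continuousAt.comp hτ)
  have hclose : ∀ᶠ m in 𝓝 m₀, ∀ i : Fin (N + 1), ‖(p m).coeff i - (p m₀).coeff i‖ < ε := by
    rw [eventually_all]
    intro i
    have h := (Metric.tendsto_nhds.1 (hcoef i)) ε hεpos
    simpa only [dist_eq_norm] using h
  -- a good parameter `m`
  obtain ⟨m, hmD, ⟨ψm, hψmc, hψmℓ⟩, hmclose, hmuniq⟩ :=
    ((hdense D hD0).and_eventually (hbranch.and (hclose.and huniq'))).exists
  have hrootm : (g m).IsRoot (lam m) := hroot m ψm hψmc hψmℓ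
  obtain ⟨hpm, hpdeg, hpmul⟩ := monic_divByMonic_of_isRoot (hgm m) hrootm
  have hdegeq : (p m).natDegree = (p m₀).natDegree := by
    change (g m /ₘ (X - C (lam m))).natDegree = (g m₀ /ₘ (X - C (lam m₀))).natDegree
    rw [hpdeg, hp₀deg, hgdeg, hgdeg]
  have hcoeffall : ∀ i : ℕ, ‖(p m).coeff i - (p m₀).coeff i‖ < ε := by
    intro i
    by_cases hi : i < N + 1
    · exact hmclose ⟨i, hi⟩
    · have h1 : (p m).coeff i = 0 := by
        refine coeff_eq_zero_of_natDegree_lt ?_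
        change (g m /ₘ (X - C (lam m))).natDegree < i
        rw [hpdeg, hgdeg]; omega
      have h2 : (p m₀).coeff i = 0 := by
        refine coeff_eq_zero_of_natDegree_lt ?_
        change (g m₀ /ₘ (X - C (lam m₀))).natDegree < i
        rw [hp₀deg, hgdeg]; omega
      rw [h1, h2, sub_zero, norm_zero]
      exact hεpos
  -- continuity of roots: a root `b` of `p_m` close to `λ(m₀)`
  obtain ⟨b, hb, hbclose⟩ := exists_roots_norm_sub_lt_of_norm_coeff_sub_lt hεpos hp₀root hp₀m hpm
    hdegeq hcoeffall (IsAlgClosed.splits _)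
  have hbη : ‖b - lam m₀‖ < η := by
    rw [norm_sub_rev]; exact lt_of_lt_of_le hbclose hrad.le
  have hpb : (p m).IsRoot b := (mem_roots hpm.ne_zero).1 hb
  have hgb : (g m).IsRoot b := by
    rw [IsRoot, ← hpmul, eval_mul]
    change eval b (X - C (lam m)) * eval b (p m) = 0
    rw [hpb.eq_zero, mul_zero]
  -- `b` comes from a point over `τ m`, hence equals `λ(m)`
  obtain ⟨ψ, hψc, hψℓ⟩ := exists_algHom_of_isRoot ℓ (τ m) b hgb
  have hblam : b = lam m := by
    rw [← hψℓ]
    exact hmuniq ψ hψc (by rw [hψℓ]; exact hbη)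
  -- so `λ(m)` is a double root of the separable `g_m`
  have hsep : (g m).Separable := hDsep (τ m) hmD
  have hdvd : (X - C (lam m)) * (X - C (lam m)) ∣ g m := by
    rw [← hpmul]
    refine mul_dvd_mul_left _ ?_
    have hpl : (p m).IsRoot (lam m) := hblam ▸ hpb
    rw [dvd_iff_isRoot]
    exact hpl
  exact Polynomial.not_isUnit_X_sub_C (lam m) (hsep.squarefree _ hdvd)

end RootCounting

open Filter in
/-- **Registered sub-goal `stub_algebraisationSmooth_rootCounting`** of the stub
`stub_algebraisationSmooth` (part (B): a single-valued continuous branch of an integral element is a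
simple root, `RootCounting.derivative_eval_ne_zero_of_branch`). [cite: SerreGAGA1956, §2 n°6 Prop. 3 and Cor.] -/
theorem stub_algebraisationSmooth_rootCounting :
    ∀ ⦃d : ℕ⦄ ⦃B : Type⦄ [CommRing B] [IsDomain B] [Algebra ℂ B] [Algebra (MvPolynomial (Fin d) ℂ) B]
      [IsScalarTower ℂ (MvPolynomial (Fin d) ℂ) B] [Module.IsTorsionFree (MvPolynomial (Fin d) ℂ) B]
      [Algebra.IsIntegral (MvPolynomial (Fin d) ℂ) B] (ℓ : B) ⦃S : Type⦄ [TopologicalSpace S] (m₀ : S)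
      (τ : S → (Fin d → ℂ)) (lam : S → ℂ), ContinuousAt τ m₀ → ContinuousAt lam m₀ →
      (∀ᶠ m in nhds m₀, ∃ ψ : B →ₐ[ℂ] ℂ,
        (fun i => ψ (algebraMap (MvPolynomial (Fin d) ℂ) B (MvPolynomial.X i))) = τ m ∧ ψ ℓ = lam m) →
      (∀ D : MvPolynomial (Fin d) ℂ, D ≠ 0 → ∃ᶠ m in nhds m₀, MvPolynomial.eval (τ m) D ≠ 0) →
      (∃ η : ℝ, 0 < η ∧ ∀ᶠ m in nhds m₀, ∀ ψ : B →ₐ[ℂ] ℂ,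
        (fun i => ψ (algebraMap (MvPolynomial (Fin d) ℂ) B (MvPolynomial.X i))) = τ m →
        ‖ψ ℓ - lam m₀‖ < η → ψ ℓ = lam m) →
      (((minpoly (MvPolynomial (Fin d) ℂ) ℓ).map (MvPolynomial.eval (τ m₀))).derivative).eval (lam m₀) ≠ 0 :=
  fun _ _ _ _ _ _ _ _ _ ℓ _ _ m₀ τ lam hτ hlam hbranch hdense huniq =>
    RootCounting.derivative_eval_ne_zero_of_branch ℓ m₀ τ lam hτ hlam hbranch hdense huniq

end Summit.HodgeConjecture.HodgeConjecture.Theorems.RiemannWeightOne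

end
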